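import Summits.HodgeConjecture.CorCM.MultiFieldWeilAnyTwoSimpleDimLeThreeAnyCurves
import Summits.HodgeConjecture.CorCM.CMAbelianFourfoldPowers
import HarnessLib

/-!
# MULTI-FIELD WEIL ENGINE — ON THE VARIETY: a complex abelian variety of CM type whose simple isogeny factors have dimension `≤ 3`, at most TWO of them (up to
# isogeny) of dimension `≥ 2`, satisfies the Hodge conjecture together with everything dominated by its powers — given ONLY Markman's fourfold theorem

Cell `pub-hodgecm2` (COR-CM), seat b30 gen 34 (2026-08-25); count-neutral own lane MULTI-FIELD WEIL ENGINE (stem `MultiFieldWeil*`) — the INTRINSIC form of the gen-34 capstone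
`CorCM/MultiFieldWeilAnyTwoSimpleDimLeThreeAnyCurves.lean` (realisation families `Sum.elim ![A₀, A₁] E`), in the shape of seat b16's classification
`CorCM/CMAbelianFactorsDimLeThreeClassification.lean` (read on the variety, Milne's regrouping `exists_isIsogeny_biproduct_of_isSimple_of_isOfCMType`).  Theorems only; no
definition, no named fact, no `sorry`.  HONEST FRAMING: conditional on the displayed Markman fourfold binder only; `HC_CM` is NOT proved and not asserted — this is a
statement about a NAMED CLASS of CM abelian varieties (bounded factor dimensions, at most two non-elliptic factor classes), not about all of them.

THE STATEMENT (**`hodgeConjectureFor_of_avDominatedBy_powSucc_of_isOfCMType_of_atMostTwo_nonCurve_factors_of_markman`**).  Let `X` be a complex abelian variety of CM type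
(`Milne1999.IsOfCMType X`) such that (a) every SIMPLE isogeny factor of `X` (`B` simple with `AVDominatedBy B X`) has dimension `≤ 3`, and (b) among any THREE simple isogeny
factors of dimension `≥ 2` two are isogenous (at most two isogeny classes of non-elliptic simple factors).  Then EVERY complex abelian variety dominated by a power `X^{N+1}` —
every power of `X`, everything isogenous to one, every abelian subvariety or quotient of one — satisfies the Hodge conjecture, GIVEN ONLY
`Markman2025_weilClasses_algebraic_abelianFourfold`.  Seat b16's classification says which of these `X` have all powers DIVISOR-generated (unconditionally): exactly those
without two non-isogenous factors through one imaginary quadratic field; for all the others the exceptional Hodge classes come from Weil classes of the fourfolds `E × T`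
(a CM elliptic curve times a simple CM threefold through its field), algebraic by Markman.

PROOF.  Milne's regrouping writes `X ∼ ⨁_i A'_{cls i}` with `A'_c` simple, pairwise non-isogenous, CM-realised; (a) bounds their dimensions by `3`, (b) leaves at most two slots
`c₀, c₁` of dimension `≥ 2`; the slot map `c ↦ inl 0 ∕ inl 1 ∕ inr c` identifies the family with `Sum.elim ![A'_{c₀}, A'_{c₁}] (curves)`, every power `X^{N+1}` is dominated by a
product of copies (`exists_avDominatedBy_powSucc_biproduct_slots`), and the capstone applies.

[cite: MoonenZarhin1999LowDim, Thm. (0.1), Thm. (0.2), §3 (3.1), Cor. (3.9), §5 (5.2)] [cite: Markman2025SurveySecant, Thm. 1.2] [cite: Milne1999LefschetzClasses, §1 Prop. 1.1]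
[cite: MumfordAV1970, §19 Thm. 1, Cor. 1–2 and p. 169] [cite: Gordon1999HodgeAVSurvey, §3 Theorem (proof), 7.4–7.7, 10.10]

## References
* [MoonenZarhin1999LowDim] B. Moonen, Yu. Zarhin, Math. Ann. 315 (1999) 711–733.  [Markman2025SurveySecant] E. Markman, arXiv:2509.23403, Thm. 1.2.
  [Milne1999LefschetzClasses] J. S. Milne, *Lefschetz classes on abelian varieties*, Duke Math. J. 96 (1999), §1 Prop. 1.1.  [MumfordAV1970] D. Mumford, *Abelian
  Varieties*, §19.  [Gordon1999HodgeAVSurvey] B. B. Gordon, *A survey of the Hodge conjecture for abelian varieties*, §3, 7.4–7.7, 10.10.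
-/

noncomputable section

open CategoryTheory CategoryTheory.Limits NumberField IntermediateField

namespace Summit.HodgeConjecture.CorCM.MultiFieldWeil

open Literature.AlgebraicGeometry Literature.AlgebraicGeometry.Motives Literature.AlgebraicGeometry.HodgeTheory
open Literature.AlgebraicGeometry.Motives.AbelianVariety
open Literature.AlgebraicGeometry.ComplexMultiplication (IsCMTypeRealisation)
open Literature.AlgebraicTopology.SingularHomology
open Literature.NumberTheory.ComplexMultiplication
open Literature.AlgebraicGeometry.Milne1999 (IsOfCMType)
open Summit.HodgeConjecture.CorCM.Domination

open scoped Classical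

section OnTheVariety

variable {X : AbelianVariety ℂ}

/-- Powers of a zero-dimensional abelian variety are zero-dimensional. [folklore] -/
private theorem dim_powSucc_eq_zero₃₄ (h0 : X.dim = 0) : ∀ N : ℕ, (X.powSucc N).dim = 0
  | 0 => h0
  | N + 1 => by rw [powSucc_succ, dim_prod, dim_powSucc_eq_zero₃₄ h0 N, h0]

/-- **MAIN THEOREM (on the variety) — AT MOST TWO NON-ELLIPTIC SIMPLE FACTORS, ALL OF DIMENSION `≤ 3`, given ONLY Markman's fourfold theorem.**  `X` a complex abelian variety of
CM type; (a) every simple isogeny factor of `X` has dimension `≤ 3`; (b) among any three simple isogeny factors of dimension `≥ 2`, two are isogenous.  Then every complex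
abelian variety dominated by a power `X^{N+1}` satisfies the Hodge conjecture, GIVEN ONLY `Markman2025_weilClasses_algebraic_abelianFourfold` (Milne's regrouping into simple
pairwise non-isogenous CM-realised factors, then the capstone `hodgeConjectureFor_of_avDominatedBy_prod_any_two_simple_dim_le_three_anyCurves_of_markman`).  `HC_CM` is NOT
asserted. [cite: Milne1999LefschetzClasses, §1 Prop. 1.1] [cite: MoonenZarhin1999LowDim, Thm. (0.1), (0.2), §3 (3.1), Cor. (3.9)] [cite: Markman2025SurveySecant, Thm. 1.2]
[cite: MumfordAV1970, §19 Thm. 1, Cor. 1–2] -/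
theorem hodgeConjectureFor_of_avDominatedBy_powSucc_of_isOfCMType_of_atMostTwo_nonCurve_factors_of_markman
    (hW4 : Markman2025_weilClasses_algebraic_abelianFourfold) (hcm : IsOfCMType X)
    (h3 : ∀ B : AbelianVariety ℂ, B.IsSimple → AVDominatedBy B X → B.dim ≤ 3)
    (h2 : ∀ B₀ B₁ B₂ : AbelianVariety ℂ, B₀.IsSimple → B₁.IsSimple → B₂.IsSimple → AVDominatedBy B₀ X → AVDominatedBy B₁ X → AVDominatedBy B₂ X →
      2 ≤ B₀.dim → 2 ≤ B₁.dim → 2 ≤ B₂.dim → IsIsogenous B₀ B₁ ∨ IsIsogenous B₀ B₂ ∨ IsIsogenous B₁ B₂)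
    {B : AbelianVariety ℂ} {N : ℕ} (hB : AVDominatedBy B (X.powSucc N)) : HodgeConjectureFor B.dim B.X := by
  rcases Nat.eq_zero_or_pos X.dim with h0 | hX0
  · exact hodgeConjectureFor_of_isDivisorGenerated _ (isDivisorGenerated_of_avDominatedBy hB
      (Literature.AlgebraicGeometry.Pohlmann1968.isDivisorGenerated_of_dim_eq_zero _ (dim_powSucc_eq_zero₃₄ h0 N)))
  -- Milne's regrouping: `X ∼ ⨁_i A'_{cls i}`, `A'_c` simple, pairwise non-isogenous, CM-realised
  obtain ⟨C, _, K', _, _, _, Φ', A', ι', θ', m, cls, f, hA, hs, hniso, hcls, hf⟩ := exists_isIsogeny_biproduct_of_isSimple_of_isOfCMType (X := X) hX0 hcm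
  have hXP : AVDominatedBy X (⨁ fun i => A' (cls i)) := AVDominatedBy.of_isIsogeny_hom hf (AVDominatedBy.refl _)
  have hPX : AVDominatedBy (⨁ fun i => A' (cls i)) X := AVDominatedBy.of_isIsogeny_inv hf (AVDominatedBy.refl _)
  have hslot : ∀ c, AVDominatedBy (A' c) X := fun c => by
    obtain ⟨i, rfl⟩ := hcls c
    exact (avDominatedBy_biproduct_summand (fun i => A' (cls i)) i).trans hPX
  have hdim3 : ∀ c, (A' c).dim ≤ 3 := fun c => h3 _ (hs c) (hslot c)
  have hfin : ∀ c, Module.finrank ℚ (K' c) = 2 * (A' c).dim := fun c =>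
    Literature.AlgebraicGeometry.Pohlmann1968.finrank_eq_two_mul_dim_of_isCMTypeRealisation (hA c)
  -- a slot is a curve iff its field is quadratic; the non-curve slots have dimension `≥ 2`
  have hbig : ∀ c, Module.finrank ℚ (K' c) ≠ 2 → 2 ≤ (A' c).dim := fun c hc => by
    have h := hfin c
    have hp : 0 < Module.finrank ℚ (K' c) := Module.finrank_pos
    omega
  -- at most two non-curve slots: `c₀`, `c₁`
  obtain ⟨c₀, c₁, hc⟩ : ∃ c₀ c₁ : C, ∀ c, Module.finrank ℚ (K' c) ≠ 2 → c = c₀ ∨ c = c₁ := by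
    by_cases hex : ∃ c, Module.finrank ℚ (K' c) ≠ 2
    · obtain ⟨c₀, hc₀⟩ := hex
      by_cases hex' : ∃ c, Module.finrank ℚ (K' c) ≠ 2 ∧ c ≠ c₀
      · obtain ⟨c₁, hc₁, hc₁₀⟩ := hex'
        refine ⟨c₀, c₁, fun c hcq => ?_⟩
        by_contra hne
        rw [not_or] at hne
        rcases h2 (A' c₀) (A' c₁) (A' c) (hs c₀) (hs c₁) (hs c) (hslot c₀) (hslot c₁) (hslot c) (hbig c₀ hc₀) (hbig c₁ hc₁) (hbig c hcq) with
          h01 | h0c | h1c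
        · exact hniso c₀ c₁ (Ne.symm hc₁₀) h01
        · exact hniso c₀ c (Ne.symm hne.1) h0c
        · exact hniso c₁ c (Ne.symm hne.2) h1c
      · exact ⟨c₀, c₀, fun c hcq => Or.inl (by by_contra h; exact hex' ⟨c, hcq, h⟩)⟩
    · exact ⟨cls 0, cls 0, fun c hcq => absurd ⟨c, hcq⟩ hex⟩
  -- the curve slots and the slot map onto `Fin 2 ⊕ I`
  let I : Type := {c : C // Module.finrank ℚ (K' c) = 2}
  let σ : C → Fin 2 ⊕ I := fun c => if h : Module.finrank ℚ (K' c) = 2 then Sum.inr ⟨c, h⟩ else if c = c₀ then Sum.inl 0 else Sum.inl 1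
  have hσ : ∀ c, A' c = (Sum.elim ![A' c₀, A' c₁] (fun i : I => A' i.1) (σ c) : AbelianVariety ℂ) := by
    intro c
    by_cases h : Module.finrank ℚ (K' c) = 2
    · simp only [σ, dif_pos h, Sum.elim_inr]
    · rcases hc c h with rfl | rfl
      · simp only [σ, dif_neg h]
        rfl
      · by_cases h' : c = c₀
        · simp only [σ, dif_neg h, if_pos h', Sum.elim_inl]
          rw [h']
          rfl
        · simp only [σ, dif_neg h, if_neg h', Sum.elim_inl]
          rfl
  -- every power of `X` is dominated by a product of copies of the slots, read through `σ`
  obtain ⟨n, π, hdom⟩ := exists_avDominatedBy_powSucc_biproduct_slots A' cls hXP N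
  have hfam : (fun j => A' (π j)) = fun j => (Sum.elim ![A' c₀, A' c₁] (fun i : I => A' i.1) (σ (π j)) : AbelianVariety ℂ) := funext fun j => hσ (π j)
  have hBd : AVDominatedBy B (⨁ fun j => (Sum.elim ![A' c₀, A' c₁] (fun i : I => A' i.1) (σ (π j)) : AbelianVariety ℂ)) := by
    have h := hB.trans hdom
    rw [hfam] at h
    exact h
  exact hodgeConjectureFor_of_avDominatedBy_prod_any_two_simple_dim_le_three_anyCurves_of_markman (kq := fun i : I => K' i.1) (E := fun i : I => A' i.1)
    (Ψ := fun i : I => Φ' i.1) (ιE := fun i : I => ι' i.1) (θE := fun i : I => θ' i.1) hW4 (hA c₀) (hA c₁) (hs c₀) (hs c₁) (hdim3 c₀) (hdim3 c₁)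
    (fun i => i.2) (fun i => hA i.1) (fun j => σ (π j)) hBd

/-- **In particular the Hodge conjecture for `X` itself** (and for all its powers): a complex abelian variety of CM type with simple isogeny factors of dimension `≤ 3`, at
most two of them non-elliptic up to isogeny, given only Markman's fourfold theorem. [cite: MoonenZarhin1999LowDim, Thm. (0.1), (0.2)] [cite: Markman2025SurveySecant, Thm. 1.2] -/
theorem hodgeConjectureFor_powSucc_of_isOfCMType_of_atMostTwo_nonCurve_factors_of_markman (hW4 : Markman2025_weilClasses_algebraic_abelianFourfold)
    (hcm : IsOfCMType X) (h3 : ∀ B : AbelianVariety ℂ, B.IsSimple → AVDominatedBy B X → B.dim ≤ 3)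
    (h2 : ∀ B₀ B₁ B₂ : AbelianVariety ℂ, B₀.IsSimple → B₁.IsSimple → B₂.IsSimple → AVDominatedBy B₀ X → AVDominatedBy B₁ X → AVDominatedBy B₂ X →
      2 ≤ B₀.dim → 2 ≤ B₁.dim → 2 ≤ B₂.dim → IsIsogenous B₀ B₁ ∨ IsIsogenous B₀ B₂ ∨ IsIsogenous B₁ B₂)
    (N : ℕ) : HodgeConjectureFor (X.powSucc N).dim (X.powSucc N).X :=
  hodgeConjectureFor_of_avDominatedBy_powSucc_of_isOfCMType_of_atMostTwo_nonCurve_factors_of_markman hW4 hcm h3 h2 (AVDominatedBy.refl _)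

end OnTheVariety

end Summit.HodgeConjecture.CorCM.MultiFieldWeil

end
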